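import Literature.AlgebraicGeometry.Frobenioids.ArchimedeanUnitStabilizersThm36v
import Literature.AlgebraicGeometry.Frobenioids.ArchimedeanUnitCircleAngular
import Literature.AlgebraicGeometry.Frobenioids.ArchimedeanTheoremsInstances
import HarnessLib

/-!
# Frobenioids II, Theorem 3.6 (v) for the angular Frobenioid `A` (all clauses) and for `C^Λ` at
# `Λ = ℤ` — the instance statements `Thm36v_A`, `Thm36v_C` (proof-only companion)

Mochizuki, *The geometry of Frobenioids II: poly-Frobenioids*, Kyushu J. Math. **62** (2008) 401–460,
§3, Theorem 3.6 (v), kurims p. 37 [cite: MochizukiFrdII2008, Thm 3.6 (v) p.37]: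

> (v) Let `A ∈ Ob(F)` [`F ∈ {C^Λ, A}`]. Then the group `O^×(A)` is trivial if and only if one of the
> following holds: (a) `Λ = ℤ` and `A` is complex non-isotropic; (b) `Λ = ℚ` and `A` is real; (c) `Λ = ℝ`.
> The group `O^×(A)` is of order two if and only if `Λ = ℤ` and `A` is real. The group `O^×(A)` has
> infinitely many torsion elements [and is in fact isomorphic to `S¹`] if and only if `Λ = ℤ` and `A` is
> complex isotropic. The group `O^×(A)` is nontrivial and torsion-free [and in fact isomorphic to
> `S¹ ⊗ ℚ`] if and only if `Λ = ℚ` and `A` is complex.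

PROOF-ONLY companion (abc-iut cell, layer L1, DAG node `FrdII:Thm3.6(v)`; seat abc-iut-w4-d027, row M6b)
of abc-iut-L1-t9's instance statements `ArchFrd.Thm36v_A π` and `ArchFrd.Thm36v_C π pf rlf`
(`ArchimedeanTheoremsInstances.lean`). For the archimedean Frobenioid `C = C^ℤ` the five clauses are
abc-iut-L6-d7's `UnitStab.thm36v_*_C` (`ArchimedeanUnitStabilizersThm36v.lean`) and the bracket `≅ S¹`
is t9's `thm36v_isoCircle_C`; for the ANGULAR Frobenioid `A ⊆ C` (Ex. 3.3 (iii): the wide subcategory of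
isometries, structure `A.toElem π` over the zero divisor monoid) the bracket is t9's `thm36v_isoCircle_A`
(`ArchimedeanUnitCircleAngular.lean`). This file supplies the remaining five clauses for `A` by TRANSPORT
along a group isomorphism `O^×_A(X) ≃* O^×_C(X)` (`A.nonempty_unitsEquiv`): an automorphism of `X` in `A` that is
a base-identity linear isomorphism is one in `C` (the conditions are literally the same, cf. t9's
`A.mapIso_mem_unitsSubgroup`), the inclusion `A → C` is faithful, and conversely every automorphism of
`C` is an isometry — `Φ = ℝ_{≥0}` is sharp (`isSharp_nnreal`, `PreFrobenioid.isUnit_div_of_isIso`) — hence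
an automorphism of `A`; together with Example 3.3 (iii) "the isotropic objects of `A` are precisely the
isotropic objects of `C`" (abc-iut-L1-t6's `Ex33iii_isotropic_iff_holds`). Results:

* `thm36v_trivial_A`, `thm36v_orderTwo_A`, `thm36v_torsion_A`, `thm36v_torsionFree_A`,
  `thm36v_isoCircleTensorRat_A` — the five clauses at `F := A.toElem π`, `Λ := ℤ`;
* `thm36v_A_holds : ArchFrd.Thm36v_A π` — the instance statement for `A`, IN FULL;
* `thm36v_C_Z` — all six clauses for `C^ℤ = C` (`archFrobenioid_Z`), and `thm36v_C_iff`: the instance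
  statement `Thm36v_C π pf rlf` is EQUIVALENT to its two `Λ ∈ {ℚ, ℝ}` conjuncts, which concern
  `C^ℚ := C^pf`, `C^ℝ := C^rlf` typed through the uninterpreted interface `ArchFrd.LambdaCompletion` and
  are therefore not dischargeable as typed (finding T36v-F1, same shape as the layer's T36x-F1 /
  T36ix-F1; they become dischargeable once `pf`, `rlf` are bound to the constructed perfection /
  realification). No new `Prop` is introduced.

Classical bookkeeping; no statement of the paper is strengthened; nothing here bears on [IUTchIII] Cor. 3.12.
-/

namespace Literature.AlgebraicGeometry.Frobenioids

open CategoryTheory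

universe v u

namespace ArchFrd

variable {D : Type u} [Category.{v} D] (π : D ⥤ D0)

/-- Finite order is invariant under a group isomorphism (via `MulEquiv.orderOf_eq`).
[cite: MochizukiFrdII2008, Thm 3.6 (v) p.37] -/
theorem isOfFinOrder_mulEquiv {G H : Type*} [Monoid G] [Monoid H] (e : G ≃* H) (x : G) :
    IsOfFinOrder (e x) ↔ IsOfFinOrder x := by
  rw [← orderOf_pos_iff, MulEquiv.orderOf_eq, orderOf_pos_iff]

/-! ### `O^×_A(X) ≃ O^×_C(X)` -/

/-- Every isomorphism of `C` is an isometry (`Φ = ℝ_{≥0}` is sharp: the divisor of an isomorphism is a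
unit, [FrdI] Rem. 1.1.1). [cite: MochizukiFrdII2008, Ex 3.3 (iii) p.29] -/
theorem C.isIsometry_of_isIso {X Y : C π} (f : X ⟶ Y) [IsIso f] :
    PreFrobenioid.IsIsometry (C.toElem π) f :=
  isSharp_nnreal.eq_one_of_isUnit _ (PreFrobenioid.isUnit_div_of_isIso (C.toElem π) f)

/-- **`O^×_A(X) ≅ O^×_C(X)`**: the group of units of an object of the angular Frobenioid `A` is
isomorphic — via the (faithful) inclusion `A → C` — to the group of units of the same object of `C`
(Ex. 3.3 (iii): `A ⊆ C` is the subcategory of isometries; a unit of `A` is a unit of `C` by the same two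
conditions, cf. abc-iut-L1-t9's `A.mapIso_mem_unitsSubgroup`, and conversely every automorphism of `C` is
an isometry, `C.isIsometry_of_isIso`, hence an automorphism of `A`). Stated as `Nonempty` (proof-only
file). [cite: MochizukiFrdII2008, Thm 3.6 (v) p.37] -/
theorem A.nonempty_unitsEquiv (X : A π) :
    Nonempty (PreFrobenioid.unitsSubgroup (A.toElem π) X ≃*
      PreFrobenioid.unitsSubgroup (C.toElem π) X.obj) := by
  let f : PreFrobenioid.unitsSubgroup (A.toElem π) X →* PreFrobenioid.unitsSubgroup (C.toElem π) X.obj :=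
    (((A.ι π).mapAut X).comp (PreFrobenioid.unitsSubgroup (A.toElem π) X).subtype).codRestrict _
      (fun u => A.mapIso_mem_unitsSubgroup π X u.1 u.2)
  refine ⟨MulEquiv.ofBijective f ⟨?_, ?_⟩⟩
  · intro u w h
    apply Subtype.ext
    have h' : (A.ι π).mapIso (u : Aut X) = (A.ι π).mapIso (w : Aut X) :=
      congrArg (fun z : PreFrobenioid.unitsSubgroup (C.toElem π) X.obj => (z : Aut X.obj)) h
    exact (A.ι π).mapIso_injective h'
  · rintro ⟨u, hu⟩
    refine ⟨⟨CategoryTheory.isoMk u (C.isIsometry_of_isIso π u.hom) (C.isIsometry_of_isIso π u.inv),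
      hu.1, hu.2⟩, Subtype.ext ?_⟩
    exact Iso.ext rfl

/-- Same cardinality of the unit groups in `A` and in `C`. [cite: MochizukiFrdII2008, Thm 3.6 (v) p.37] -/
theorem A.card_unitsSubgroup (X : A π) :
    Nat.card (PreFrobenioid.unitsSubgroup (A.toElem π) X) =
      Nat.card (PreFrobenioid.unitsSubgroup (C.toElem π) X.obj) := by
  obtain ⟨e⟩ := A.nonempty_unitsEquiv π X
  exact Nat.card_congr e.toEquiv

/-- `O^×_A(X)` is trivial iff `O^×_C(X)` is. [cite: MochizukiFrdII2008, Thm 3.6 (v) p.37] -/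
theorem A.unitsSubgroup_eq_bot_iff (X : A π) :
    PreFrobenioid.unitsSubgroup (A.toElem π) X = ⊥ ↔
      PreFrobenioid.unitsSubgroup (C.toElem π) X.obj = ⊥ := by
  rw [Subgroup.eq_bot_iff_card, Subgroup.eq_bot_iff_card, A.card_unitsSubgroup]

/-- `O^×_A(X)` has infinitely many torsion elements iff `O^×_C(X)` does (torsion elements correspond under
the isomorphism). [cite: MochizukiFrdII2008, Thm 3.6 (v) p.37] -/
theorem A.torsion_infinite_iff (X : A π) :
    {u : PreFrobenioid.unitsSubgroup (A.toElem π) X | IsOfFinOrder u}.Infinite ↔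
      {w : PreFrobenioid.unitsSubgroup (C.toElem π) X.obj | IsOfFinOrder w}.Infinite := by
  obtain ⟨e⟩ := A.nonempty_unitsEquiv π X
  have himg : e '' {u : PreFrobenioid.unitsSubgroup (A.toElem π) X | IsOfFinOrder u} =
      {w : PreFrobenioid.unitsSubgroup (C.toElem π) X.obj | IsOfFinOrder w} := by
    ext w
    constructor
    · rintro ⟨u, hu, rfl⟩
      exact (isOfFinOrder_mulEquiv e u).mpr hu
    · intro hw
      exact ⟨e.symm w, (isOfFinOrder_mulEquiv e.symm w).mpr hw, MulEquiv.apply_symm_apply _ _⟩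
  rw [← himg, Set.infinite_image_iff (e.injective.injOn)]

/-- "isotropic in `A`" iff "isotropic in `C`" (Ex. 3.3 (iii), abc-iut-L1-t6). [cite: MochizukiFrdII2008, Ex 3.3 (iii) p.29] -/
theorem A.isIsotropic_iff (X : A π) :
    PreFrobenioid.IsIsotropic (A.toElem π) X ↔ PreFrobenioid.IsIsotropic (C.toElem π) X.obj :=
  Ex33iii_isotropic_iff_holds π X

/-! ### Theorem 3.6 (v) for `A` -/

/-- **Thm. 3.6 (v), "`O^×(A)` trivial iff (a)/(b)/(c)", for the angular Frobenioid `A`** (`Λ = ℤ`), over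
any base `π : D → D₀`. [cite: MochizukiFrdII2008, Thm 3.6 (v) p.37] -/
theorem thm36v_trivial_A : Thm36v_trivial (π ⋙ D0.toArchBase) (A.toElem π) MonoidType.Z := by
  intro X
  rw [A.unitsSubgroup_eq_bot_iff, A.isIsotropic_iff]
  exact UnitStab.thm36v_trivial_C π X.obj

/-- **Thm. 3.6 (v), "`O^×(A)` of order two iff `Λ = ℤ` and `A` real", for `A`**.
[cite: MochizukiFrdII2008, Thm 3.6 (v) p.37] -/
theorem thm36v_orderTwo_A : Thm36v_orderTwo (π ⋙ D0.toArchBase) (A.toElem π) MonoidType.Z := by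
  intro X
  rw [A.card_unitsSubgroup]
  exact UnitStab.thm36v_orderTwo_C π X.obj

/-- **Thm. 3.6 (v), "`O^×(A)` has infinitely many torsion elements iff `Λ = ℤ` and `A` complex
isotropic", for `A`**. [cite: MochizukiFrdII2008, Thm 3.6 (v) p.37] -/
theorem thm36v_torsion_A : Thm36v_torsion (π ⋙ D0.toArchBase) (A.toElem π) MonoidType.Z := by
  intro X
  rw [A.torsion_infinite_iff, A.isIsotropic_iff]
  exact UnitStab.thm36v_torsion_C π X.obj

/-- **Thm. 3.6 (v), "`O^×(A)` nontrivial and torsion-free iff `Λ = ℚ` and `A` complex", for `A`**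
(at `Λ = ℤ` both sides fail). [cite: MochizukiFrdII2008, Thm 3.6 (v) p.37] -/
theorem thm36v_torsionFree_A : Thm36v_torsionFree (π ⋙ D0.toArchBase) (A.toElem π) MonoidType.Z := by
  intro X
  constructor
  · rintro ⟨hne, htf⟩
    exfalso
    have hC : PreFrobenioid.unitsSubgroup (C.toElem π) X.obj ≠ ⊥ ∧
        ∀ w : PreFrobenioid.unitsSubgroup (C.toElem π) X.obj, IsOfFinOrder w → w = 1 := by
      obtain ⟨e⟩ := A.nonempty_unitsEquiv π X
      refine ⟨fun h => hne ((A.unitsSubgroup_eq_bot_iff π X).mpr h), fun w hw => ?_⟩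
      have hu : IsOfFinOrder (e.symm w) := (isOfFinOrder_mulEquiv e.symm w).mpr hw
      have h1 := htf _ hu
      rw [← MulEquiv.apply_symm_apply e w, h1, map_one]
    obtain ⟨h, -⟩ := (UnitStab.thm36v_torsionFree_C π X.obj).mp hC
    cases h
  · rintro ⟨h, -⟩
    cases h

/-- **Thm. 3.6 (v), bracket "`O^×(A) ≅ S¹ ⊗_ℤ ℚ` for `Λ = ℚ`, `A` complex", for `A`**: vacuous at `Λ = ℤ`.
[cite: MochizukiFrdII2008, Thm 3.6 (v) p.37] -/
theorem thm36v_isoCircleTensorRat_A :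
    Thm36v_isoCircleTensorRat (π ⋙ D0.toArchBase) (A.toElem π) MonoidType.Z := by
  intro h
  cases h

/-- **Thm. 3.6 (v) for the angular Frobenioid `A` — the instance statement `Thm36v_A` DISCHARGED IN FULL**
(all five clauses + the bracket `O^×(A) ≅ S¹`, the latter abc-iut-L1-t9's `thm36v_isoCircle_A`), over any
base `π : D → D₀`. [cite: MochizukiFrdII2008, Thm 3.6 (v) p.37] -/
theorem thm36v_A_holds : Literature.AlgebraicGeometry.Frobenioids.ArchFrd.Thm36v_A π :=
  ⟨thm36v_trivial_A π, thm36v_torsionFree_A π, thm36v_isoCircleTensorRat_A π, thm36v_orderTwo_A π,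
    thm36v_torsion_A π, thm36v_isoCircle_A π⟩

/-- `Thm36v_A` — `_holds` alias of `thm36v_A_holds` above under the fact's exact name (appended
2026-08-28, D-0026 bookkeeping: the proof term is the existing theorem of this file; no statement,
definition or attribute is edited; no new named fact; the ledger's debt table listed the fact
unproved). [cite: MochizukiFrdII2008, Thm 3.6 (v) p.37] -/
theorem _root_.Literature.AlgebraicGeometry.Frobenioids.ArchFrd.Thm36v_A_holds :
    Literature.AlgebraicGeometry.Frobenioids.ArchFrd.Thm36v_A π :=
  _root_.Literature.AlgebraicGeometry.Frobenioids.ArchFrd.thm36v_A_holds (π := π)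

/-! ### Theorem 3.6 (v) for `C^Λ` -/

variable (pf rlf : LambdaCompletion π)

/-- **Thm. 3.6 (v) for `C^ℤ = C`**: the `Λ = ℤ` conjunct of the instance statement `Thm36v_C` — all six
clauses (abc-iut-L6-d7's `UnitStab.thm36v_*_C` and abc-iut-L1-t9's `thm36v_isoCircle_C`, transported
along `archFrobenioid_Z`). [cite: MochizukiFrdII2008, Thm 3.6 (v) p.37] -/
theorem thm36v_C_Z :
    Thm36v_trivial (baseRC π) (archFrobenioid π pf rlf .Z).str .Z ∧
      Thm36v_torsionFree (baseRC π) (archFrobenioid π pf rlf .Z).str .Z ∧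
      Thm36v_isoCircleTensorRat (baseRC π) (archFrobenioid π pf rlf .Z).str .Z ∧
      Thm36v_orderTwo (baseRC π) (archFrobenioid π pf rlf .Z).str .Z ∧
      Thm36v_torsion (baseRC π) (archFrobenioid π pf rlf .Z).str .Z ∧
      Thm36v_isoCircle (baseRC π) (archFrobenioid π pf rlf .Z).str .Z :=
  ⟨UnitStab.thm36v_trivial_C π, UnitStab.thm36v_torsionFree_C π, UnitStab.thm36v_isoCircleTensorRat_C π,
    UnitStab.thm36v_orderTwo_C π, UnitStab.thm36v_torsion_C π, thm36v_isoCircle_C π⟩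

/-- **Thm. 3.6 (v) for `C^Λ`, instance statement — what it reduces to.** `Thm36v_C π pf rlf` holds iff its
clauses hold at every `Λ ≠ ℤ`, i.e. at the completion data `pf` (`C^ℚ := C^pf`) and `rlf` (`C^ℝ := C^rlf`);
the `Λ = ℤ` conjunct is `thm36v_C_Z`. The `Λ ∈ {ℚ, ℝ}` clauses concern the uninterpreted interface
`LambdaCompletion` (finding T36v-F1, module docstring). [cite: MochizukiFrdII2008, Thm 3.6 (v) p.37] -/
theorem thm36v_C_iff :
    Literature.AlgebraicGeometry.Frobenioids.ArchFrd.Thm36v_C π pf rlf ↔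
      ∀ Λ : MonoidType, Λ ≠ .Z →
        Thm36v_trivial (baseRC π) (archFrobenioid π pf rlf Λ).str Λ ∧
          Thm36v_torsionFree (baseRC π) (archFrobenioid π pf rlf Λ).str Λ ∧
          Thm36v_isoCircleTensorRat (baseRC π) (archFrobenioid π pf rlf Λ).str Λ ∧
          Thm36v_orderTwo (baseRC π) (archFrobenioid π pf rlf Λ).str Λ ∧
          Thm36v_torsion (baseRC π) (archFrobenioid π pf rlf Λ).str Λ ∧
          Thm36v_isoCircle (baseRC π) (archFrobenioid π pf rlf Λ).str Λ := by
  constructor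
  · intro h Λ _
    exact h Λ
  · intro h Λ
    cases Λ with
    | Z => exact thm36v_C_Z π pf rlf
    | Q => exact h .Q (by decide)
    | R => exact h .R (by decide)

end ArchFrd

end Literature.AlgebraicGeometry.Frobenioids
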